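import Mathlib

/-!
# Solo-blind kernel #263: the explicit outer-tail integral of the [A′] assembly

On the line `Im x = -y_L` the certified assembler bounds the remainder beyond its last box by
`|R(ω)| ≤ a/ω + b/ω² + c/ω³` (kernel #262, `explicit_tail_bound`).  The L²-mass of that tail is the
closed form proved here:

`∫_{ω > Ω} (a/ω + b/ω² + c/ω³)² dω = a²/Ω + a b/Ω² + (2ac + b²)/(3Ω³) + b c/(2Ω⁴) + c²/(5Ω⁵)`  (`Ω > 0`),

assembled from `∫_{ω > Ω} ω^{-(n+2)} dω = Ω^{-(n+1)}/(n+1)`.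
-/

namespace Summit.AnomalousDissipation.SoloBlind.TailSqIntegral

open MeasureTheory Set Real

/-- For `ω > 0`: `(ω^(n+2))⁻¹ = ω ^ (-( (n+2 : ℕ) : ℝ))` (real power). -/
theorem inv_pow_eq_rpow {ω : ℝ} (hω : 0 < ω) (n : ℕ) :
    (ω ^ (n + 2))⁻¹ = ω ^ (-((n + 2 : ℕ) : ℝ)) := by
  rw [Real.rpow_neg hω.le, Real.rpow_natCast]

/-- Integrability of `ω ↦ (ω^(n+2))⁻¹` on `(Ω, ∞)` for `Ω > 0`. -/
theorem integrableOn_inv_pow {Ω : ℝ} (hΩ : 0 < Ω) (n : ℕ) :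
    IntegrableOn (fun ω : ℝ => (ω ^ (n + 2))⁻¹) (Ioi Ω) := by
  have hlt : (-((n + 2 : ℕ) : ℝ)) < -1 := by push_cast; linarith
  have h := integrableOn_Ioi_rpow_of_lt hlt hΩ
  refine h.congr_fun ?_ measurableSet_Ioi
  intro ω hω
  have hω' : 0 < ω := lt_trans hΩ hω
  simp only
  rw [inv_pow_eq_rpow hω' n]

/-- `∫_{ω > Ω} (ω^(n+2))⁻¹ dω = (Ω^(n+1))⁻¹ / (n+1)` for `Ω > 0`. -/
theorem integral_inv_pow {Ω : ℝ} (hΩ : 0 < Ω) (n : ℕ) :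
    ∫ ω in Ioi Ω, (ω ^ (n + 2))⁻¹ = (Ω ^ (n + 1))⁻¹ / ((n : ℝ) + 1) := by
  have hlt : (-((n + 2 : ℕ) : ℝ)) < -1 := by push_cast; linarith
  have hcongr : ∫ ω in Ioi Ω, (ω ^ (n + 2))⁻¹ = ∫ ω in Ioi Ω, ω ^ (-((n + 2 : ℕ) : ℝ)) := by
    refine setIntegral_congr_fun measurableSet_Ioi ?_
    intro ω hω
    have hω' : 0 < ω := lt_trans hΩ hω
    simp only
    rw [inv_pow_eq_rpow hω' n]
  rw [hcongr, integral_Ioi_rpow_of_lt hlt hΩ]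
  have hexp : (-((n + 2 : ℕ) : ℝ)) + 1 = -(((n + 1 : ℕ) : ℝ)) := by push_cast; ring
  rw [hexp, Real.rpow_neg hΩ.le, Real.rpow_natCast]
  have hn : ((n : ℝ) + 1) ≠ 0 := by positivity
  push_cast
  field_simp

/-- Pointwise expansion of the squared tail model (for `ω ≠ 0`). -/
theorem sq_expand {a b c ω : ℝ} (hω : ω ≠ 0) :
    (a / ω + b / ω ^ 2 + c / ω ^ 3) ^ 2 =
      a ^ 2 * (ω ^ (0 + 2))⁻¹ + 2 * a * b * (ω ^ (1 + 2))⁻¹ + (2 * a * c + b ^ 2) * (ω ^ (2 + 2))⁻¹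
        + 2 * b * c * (ω ^ (3 + 2))⁻¹ + c ^ 2 * (ω ^ (4 + 2))⁻¹ := by
  field_simp
  ring

/-- THE CLOSED FORM: `∫_{ω > Ω} (a/ω + b/ω² + c/ω³)² dω` for `Ω > 0`. -/
theorem tail_sq_integral (a b c : ℝ) {Ω : ℝ} (hΩ : 0 < Ω) :
    ∫ ω in Ioi Ω, (a / ω + b / ω ^ 2 + c / ω ^ 3) ^ 2 =
      a ^ 2 / Ω + a * b / Ω ^ 2 + (2 * a * c + b ^ 2) / (3 * Ω ^ 3) + b * c / (2 * Ω ^ 4)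
        + c ^ 2 / (5 * Ω ^ 5) := by
  have hcongr : ∫ ω in Ioi Ω, (a / ω + b / ω ^ 2 + c / ω ^ 3) ^ 2 =
      ∫ ω in Ioi Ω, (a ^ 2 * (ω ^ (0 + 2))⁻¹ + 2 * a * b * (ω ^ (1 + 2))⁻¹
        + (2 * a * c + b ^ 2) * (ω ^ (2 + 2))⁻¹ + 2 * b * c * (ω ^ (3 + 2))⁻¹
        + c ^ 2 * (ω ^ (4 + 2))⁻¹) := by
    refine setIntegral_congr_fun measurableSet_Ioi ?_
    intro ω hω
    have hω' : ω ≠ 0 := ne_of_gt (lt_trans hΩ hω)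
    simp only
    exact sq_expand hω'
  rw [hcongr]
  have i0 : IntegrableOn (fun ω : ℝ => a ^ 2 * (ω ^ (0 + 2))⁻¹) (Ioi Ω) :=
    (integrableOn_inv_pow hΩ 0).const_mul (a ^ 2)
  have i1 : IntegrableOn (fun ω : ℝ => 2 * a * b * (ω ^ (1 + 2))⁻¹) (Ioi Ω) :=
    (integrableOn_inv_pow hΩ 1).const_mul (2 * a * b)
  have i2 : IntegrableOn (fun ω : ℝ => (2 * a * c + b ^ 2) * (ω ^ (2 + 2))⁻¹) (Ioi Ω) :=
    (integrableOn_inv_pow hΩ 2).const_mul (2 * a * c + b ^ 2)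
  have i3 : IntegrableOn (fun ω : ℝ => 2 * b * c * (ω ^ (3 + 2))⁻¹) (Ioi Ω) :=
    (integrableOn_inv_pow hΩ 3).const_mul (2 * b * c)
  have i4 : IntegrableOn (fun ω : ℝ => c ^ 2 * (ω ^ (4 + 2))⁻¹) (Ioi Ω) :=
    (integrableOn_inv_pow hΩ 4).const_mul (c ^ 2)
  have h01 : IntegrableOn (fun ω : ℝ => a ^ 2 * (ω ^ (0 + 2))⁻¹ + 2 * a * b * (ω ^ (1 + 2))⁻¹) (Ioi Ω) :=
    i0.add i1
  have h012 : IntegrableOn (fun ω : ℝ => a ^ 2 * (ω ^ (0 + 2))⁻¹ + 2 * a * b * (ω ^ (1 + 2))⁻¹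
      + (2 * a * c + b ^ 2) * (ω ^ (2 + 2))⁻¹) (Ioi Ω) := h01.add i2
  have h0123 : IntegrableOn (fun ω : ℝ => a ^ 2 * (ω ^ (0 + 2))⁻¹ + 2 * a * b * (ω ^ (1 + 2))⁻¹
      + (2 * a * c + b ^ 2) * (ω ^ (2 + 2))⁻¹ + 2 * b * c * (ω ^ (3 + 2))⁻¹) (Ioi Ω) := h012.add i3
  have e4 : ∫ ω in Ioi Ω, (a ^ 2 * (ω ^ (0 + 2))⁻¹ + 2 * a * b * (ω ^ (1 + 2))⁻¹
        + (2 * a * c + b ^ 2) * (ω ^ (2 + 2))⁻¹ + 2 * b * c * (ω ^ (3 + 2))⁻¹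
        + c ^ 2 * (ω ^ (4 + 2))⁻¹)
      = (∫ ω in Ioi Ω, (a ^ 2 * (ω ^ (0 + 2))⁻¹ + 2 * a * b * (ω ^ (1 + 2))⁻¹
        + (2 * a * c + b ^ 2) * (ω ^ (2 + 2))⁻¹ + 2 * b * c * (ω ^ (3 + 2))⁻¹))
        + ∫ ω in Ioi Ω, c ^ 2 * (ω ^ (4 + 2))⁻¹ := integral_add h0123 i4
  have e3 : ∫ ω in Ioi Ω, (a ^ 2 * (ω ^ (0 + 2))⁻¹ + 2 * a * b * (ω ^ (1 + 2))⁻¹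
        + (2 * a * c + b ^ 2) * (ω ^ (2 + 2))⁻¹ + 2 * b * c * (ω ^ (3 + 2))⁻¹)
      = (∫ ω in Ioi Ω, (a ^ 2 * (ω ^ (0 + 2))⁻¹ + 2 * a * b * (ω ^ (1 + 2))⁻¹
        + (2 * a * c + b ^ 2) * (ω ^ (2 + 2))⁻¹))
        + ∫ ω in Ioi Ω, 2 * b * c * (ω ^ (3 + 2))⁻¹ := integral_add h012 i3
  have e2 : ∫ ω in Ioi Ω, (a ^ 2 * (ω ^ (0 + 2))⁻¹ + 2 * a * b * (ω ^ (1 + 2))⁻¹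
        + (2 * a * c + b ^ 2) * (ω ^ (2 + 2))⁻¹)
      = (∫ ω in Ioi Ω, (a ^ 2 * (ω ^ (0 + 2))⁻¹ + 2 * a * b * (ω ^ (1 + 2))⁻¹))
        + ∫ ω in Ioi Ω, (2 * a * c + b ^ 2) * (ω ^ (2 + 2))⁻¹ := integral_add h01 i2
  have e1 : ∫ ω in Ioi Ω, (a ^ 2 * (ω ^ (0 + 2))⁻¹ + 2 * a * b * (ω ^ (1 + 2))⁻¹)
      = (∫ ω in Ioi Ω, a ^ 2 * (ω ^ (0 + 2))⁻¹) + ∫ ω in Ioi Ω, 2 * a * b * (ω ^ (1 + 2))⁻¹ :=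
    integral_add i0 i1
  rw [e4, e3, e2, e1]
  rw [integral_const_mul, integral_const_mul, integral_const_mul, integral_const_mul,
    integral_const_mul]
  rw [integral_inv_pow hΩ 0, integral_inv_pow hΩ 1, integral_inv_pow hΩ 2, integral_inv_pow hΩ 3,
    integral_inv_pow hΩ 4]
  have hΩ' : Ω ≠ 0 := ne_of_gt hΩ
  push_cast
  field_simp
  ring

end Summit.AnomalousDissipation.SoloBlind.TailSqIntegral
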